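/-
Copyright: statement-level skeleton of a published paper (lit-balaban cell, Phase-2 proof seat p19, gen 3). No claims beyond
what the kernel checks below.
-/
import Mathlib
import Literature.MathematicalPhysics.QuantumFieldTheory.Balaban1983to89.B3Ineq213Proof
import Literature.MathematicalPhysics.QuantumFieldTheory.Balaban1983to89.B3Ineq215Example

/-!
# B3 — T. Bałaban, *(Higgs)₂,₃ quantum fields in a finite volume. III. Renormalization*, CMP **88** (1983) 411–445
[Balaban1983Higgs3] — Sect. 2, pp. 425–427: a NON-VACUITY WITNESS for the localized lattice graph amplitudes of the proved
first estimate (2.13) (the subgraph `G₁` of p. 425: one scalar line)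

statement-level skeleton of published theorems with citation tags; proofs where landed; nothing here is a claim about
the Yang–Mills mass gap

PDF held: `paper:balaban1983-higgs-2-3-quantum-fields-finite-volume` (journal page = PDF page + 410); renders
`pub-balaban/b2b-balaban-ref1/pages/1983-cmp88-higgs23-III/1983-cmp88-higgs23-III-p015 … p017-x2.png` (pp. 425–427).

Companion of the Phase-2 proof of SKELETON row **B3.Eq2.13-2.14** (unit `lit-balaban-p19` gen 3; files `B3Ineq213Points` →
`B3Ineq213TreeLength` → `B3Ineq213Amplitude` → `B3Ineq213Proof`), in the spirit of gen 2's `B3Ineq215Example` for (2.15).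

WHAT IS HERE.  The hypotheses of the amplitude class `B3Ineq213.Amp` (vertex bound, kernel bounds (2.10)–(2.12),
connectedness) and of the end-to-end bound `Amp.bound133` (every connected component of every `G_i` has positive degree,
p. 426) are INHABITED by the kernel for the simplest printed graph, `G₁` of p. 425 (*"G₁ is formed by the line l(1) and two
vertices at the endpoints of this line"*): one scalar line `0 → 1` in `d = 3` as COUNT data (`oneLineC : Counts (Fin 2) 1`,
no differentiations, no averaged legs, no η-powers; `L = 2`, `δ₁ = 2`), whose generalized graph IS gen 2's `oneLine`
(`toModel_oneLineC`, so `D(G₁) = 2 > 0` is gen 2's `oneLine_pos`); the amplitude with the kernel EQUAL to the bound (2.10)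
(`K(t; x, x′) = (L^tη)^{−1} exp[−δ₁(L^tη)^{−1}|x − x′|]`, dimension `a = −(d−2) = −1`) and trivial vertex functions
(`oneLineAmp k □`), for every `k` and every placement of the two unit cubes; and the resulting unconditional instance of
the (1.33)-shaped bound (`oneLineAmp_bound133`): `|Σ_{j∈J(l̃)} E(G₁(j), {□(v)})| ≤ const215 · exp[−d({□(0), □(1)})]`.
Nothing of the paper is asserted here.
-/

open Finset

namespace Literature.MathematicalPhysics.QuantumFieldTheory.Balaban1983to89.B3Ineq213

open B3Ineq215 B3Sect2FirstEstimate

/-- The subgraph `G₁` of p. 425 as count data of (2.14): two vertices, one scalar line `0 → 1`, no differentiations, no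
averaged vector legs, no η-powers; `d = 3`, `L = 2`, `δ₁ = 2`. [cite: Balaban1983Higgs3, (2.15) p.425] -/
def oneLineC : Counts (Fin 2) 1 where
  src := fun _ => 0
  tgt := fun _ => 1
  touches := fun v => ⟨0, by fin_cases v <;> simp⟩
  diffOn := fun _ _ => 0
  vecLegAvg := fun _ _ => 0
  etaPow := fun _ => 0
  d := 3
  L := 2
  δ₁ := 2
  d_pos := by norm_num
  two_le_L := le_rfl
  δ₁_pos := by norm_num

/-- Its line dimension (2.14): two scalar legs of dimension `−(d−2)/2 = −½` each, `a = −1`.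
[cite: Balaban1983Higgs3, (2.14) p.427] -/
theorem lineDim_oneLineC (l : Fin 1) : oneLineC.lineDim l = -1 := by
  unfold Counts.lineDim Counts.legExp Counts.legsOn
  simp [oneLineC, Fin.sum_univ_two]
  norm_num

/-- The generalized graph of the count data IS gen 2's `oneLine` (`e ≡ 0`, `a ≡ −1`, `d = 3`, `L = 2`, `δ₀ = 1`).
[cite: Balaban1983Higgs3, (2.15) p.425] -/
theorem toModel_oneLineC : oneLineC.toModel = oneLine := by
  have ha : oneLineC.lineDim = fun _ => (-1 : ℝ) := funext lineDim_oneLineC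
  unfold Counts.toModel oneLine
  simp only [ha]
  congr 1
  · funext v
    simp [oneLineC]
  · simp [oneLineC]

/-- Hence the hypothesis of p. 426 (every connected component of every `G_i` has positive degree) holds for it: gen 2's
`oneLine_pos` (`D(G₁) = 2`). [cite: Balaban1983Higgs3, (2.15) p.426] -/
theorem oneLineC_pos :
    ∀ i, i ≤ 1 → ∀ b ∈ oneLineC.toModel.reps i, oneLineC.toModel.Nontriv i b → 0 < oneLineC.toModel.D i b := by
  rw [toModel_oneLineC]
  exact oneLine_pos

/-- **A localized lattice graph amplitude for `G₁`**, for every `k` (`η = 2^{−k}`) and every placement `□` of the two unit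
cubes: the line kernel EQUAL to the bound (2.10) with `a = −1` (`K(t; x, x′) = (L^tη)^{−1}exp[−δ₁(L^tη)^{−1}|x − x′|]`,
constant `C = 1`), vertex functions `u ≡ 1` (no external fields: `N^Φ = N^A = 1`, orders `d_v = d_s = 0`, couplings `1`).
All hypotheses of `Amp` are discharged by the kernel. [cite: Balaban1983Higgs3, (2.13) p.426] -/
noncomputable def oneLineAmp (k : ℕ) (box : Fin 2 → Fin 3 → ℕ) : Amp oneLineC.toModel where
  k := k
  box := box
  u := fun _ _ => 1
  K := fun l t x x' => oneLineC.toModel.sc k t ^ oneLineC.toModel.a l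
    * Real.exp (-(2 * oneLineC.toModel.δ₀ / oneLineC.toModel.sc k t
        * (((oneLineC.toModel.L : ℝ) ^ k)⁻¹ * (supDist x x' : ℝ))))
  C := fun _ => 1
  eRun := 1
  lamRun := 1
  dv := fun _ => 0
  ds := fun _ => 0
  NPhi := fun _ => 1
  NA := fun _ => 1
  C_nonneg := fun _ => zero_le_one
  eRun_nonneg := zero_le_one
  lamRun_nonneg := zero_le_one
  NPhi_nonneg := fun _ => zero_le_one
  NA_nonneg := fun _ => zero_le_one
  e_nonneg := fun v => by
    show (0 : ℝ) ≤ ((oneLineC.etaPow v : ℕ) : ℝ)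
    exact Nat.cast_nonneg _
  conn := by
    intro u w
    have h01 : Relation.EqvGen (fun a b => ∃ l, oneLineC.toModel.src l = a ∧ oneLineC.toModel.tgt l = b) 0 1 :=
      Relation.EqvGen.rel 0 1 ⟨0, rfl, rfl⟩
    fin_cases u <;> fin_cases w
    · exact Relation.EqvGen.refl _
    · exact h01
    · exact Relation.EqvGen.symm _ _ h01
    · exact Relation.EqvGen.refl _
  u_le := by
    intro v x
    have he : oneLineC.toModel.e v = 0 := by
      show ((oneLineC.etaPow v : ℕ) : ℝ) = 0
      simp [oneLineC]
    rw [he, Real.rpow_zero]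
    simp
  K_le := by
    intro l t _ x x'
    rw [one_mul]
    have hsc := oneLineC.toModel.sc_pos k t
    exact le_of_eq (abs_of_nonneg (mul_nonneg (Real.rpow_nonneg hsc.le _) (Real.exp_pos _).le))

/-- **Non-vacuity of the proved (2.13)/(1.33) chain**: for `G₁`, every `k` and every placement of the two unit cubes,
`|Σ_{j∈J(l̃)} E(G₁(j), {□(v)})| ≤ const215 · exp[−½δ₁ d({□(v)})]` — `Amp.bound133` with its hypothesis discharged by
`oneLineC_pos` (all other constants are `1`). [cite: Balaban1983Higgs3, (2.13) p.426] -/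
theorem oneLineAmp_bound133 (k : ℕ) (box : Fin 2 → Fin 3 → ℕ) :
    |∑ j ∈ Model.Mon 1 k, (oneLineAmp k box).E j|
      ≤ oneLineC.toModel.const215 * Real.exp (-(boxTreeLen 2 k box)) := by
  have h := (oneLineAmp k box).bound133 oneLineC_pos
  have h1 : (∏ l, (oneLineAmp k box).C l) = 1 := by simp [oneLineAmp]
  have h2 : (oneLineAmp k box).eRun ^ (∑ v, (oneLineAmp k box).dv v)
      * (oneLineAmp k box).lamRun ^ (∑ v, (oneLineAmp k box).ds v) = 1 := by simp [oneLineAmp]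
  have h4 : (∏ v, (oneLineAmp k box).NPhi v) = 1 := by simp [oneLineAmp]
  have h5 : (∏ v, (oneLineAmp k box).NA v) = 1 := by simp [oneLineAmp]
  have h6 : oneLineC.δ₁ / 2 = 1 := by
    show (2 : ℝ) / 2 = 1
    norm_num
  rw [h1, h2, h4, h5, h6] at h
  simp only [one_mul, mul_one] at h
  exact h

end Literature.MathematicalPhysics.QuantumFieldTheory.Balaban1983to89.B3Ineq213
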